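import Mathlib
import HarnessLib
import Summits.NavierStokesRegularity.NavierStokesRegularity.Theorems.UnthreadedDoorAntidynamoWallBeltramiFrame

/-!
# Route `UnthreadedDoor` / `ThreadingFlux`, crux `PoloidalLiouville` (stmt-NavierStokesRegularity-1222), antidynamo v2 skeleton (4ebf5683127b),
# WALL `stub_scalarLiouville`: TRANSLATION-FLAT / TRANSLATION-INVARIANT SLICES AT ACCUMULATING TIMES, AND BELTRAMI FLOWS, ARE TRIVIAL

Support file (seat leafhand-ns-unthreadeddoor-2 g1, cell decomp-ns), `--supports stmt-NavierStokesRegularity-1222 --as helper`; theorems only.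
Three short corollaries for the sector table:

* ★★ `curl_eq_zero_of_flat_direction_frequently` — unthreaded about `x₀` + at times accumulating at some `t₀ < 0` a non-zero `k` with
  `D(curl v(t))(x)[k] = 0` for all `x` ⇒ `curl v ≡ 0` (p814555 `inner_curl_eq_zero_of_fderiv_curl_apply_eq_zero` + the accumulation closer p816144;
  sharpens the far-past form p814882).
* ★★ `curl_eq_zero_of_translationInvariant_frequently` — slices invariant under a non-zero translation, `v(t, x + k) = v(t, x)` (2½-D flows, flows
  periodic in one direction), at accumulating times ⇒ trivial.
* ★★ `curl_eq_zero_of_beltrami` — BELTRAMI flows in a Galilean frame, `curl v(t, x) × (v(t, x) − b(t)) = 0` pointwise (vorticity parallel to the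
  relative velocity) with `b` smooth on `(−∞,0)` ⇒ trivial (the Lamb vector vanishes; p816997).

HONEST LABEL: corollaries; nothing here proves `stub_scalarLiouville`, `PoloidalLiouville` (1222), or bears on Navier–Stokes regularity; no summit statement
is proved (crux 1222 is INCOMPARABLE with the summit). [folklore] [cite: KochNadirashviliSereginSverak2009, Thm 5.2 (arXiv:0709.3599 pp. 9–10)]
-/

noncomputable section

-- the summit and its single sub-problem share the name (CONVENTIONS §1)
set_option linter.dupNamespace false

open scoped Topology InnerProductSpace RealInnerProductSpace ContDiff
open Filter Set Function Metric MeasureTheory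
open Literature.Analysis.FluidPDE

namespace Summit.NavierStokesRegularity.NavierStokesRegularity.Theorems.PoloidalLiouville.Antidynamo

open Summit.NavierStokesRegularity.NavierStokesRegularity.Theorems.PoloidalLiouville
  (constantOfIrrotational)

/-- ★★ **A TRANSLATION-FLAT DIRECTION OF THE VORTICITY AT ACCUMULATING TIMES ⇒ IRROTATIONAL.**  Let `v` be a bounded ancient mild solution (`ν = 1`,
duality class) with measurable slices, jointly smooth on `(−∞,0) × ℝ³` and unthreaded about `x₀`.  If at times accumulating at some `t₀ < 0` there is
`k ≠ 0` with `D(curl v(t))(x)[k] = 0` for all `x`, then `curl v ≡ 0` on `(−∞,0) × ℝ³`. [cite: KochNadirashviliSereginSverak2009, Thm 5.2 (arXiv:0709.3599 pp. 9–10)] -/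
theorem curl_eq_zero_of_flat_direction_frequently
    (v : ℝ → EuclideanSpace ℝ (Fin 3) → EuclideanSpace ℝ (Fin 3)) (x₀ : EuclideanSpace ℝ (Fin 3))
    (hB : Literature.Analysis.FluidPDE.IsBoundedAncientMildSolution 1 v)
    (hm : ∀ t < 0, AEStronglyMeasurable (v t) volume)
    (hsm : ContDiffOn ℝ (⊤ : ℕ∞) (Function.uncurry v) (Set.Iio 0 ×ˢ Set.univ))
    (hun : ∀ t < 0, ∀ x, ⟪x - x₀, curl (v t) x⟫ = 0)
    (hflat : ∃ t₀ < 0, ∃ᶠ t in 𝓝[≠] t₀, ∃ k : EuclideanSpace ℝ (Fin 3), k ≠ 0 ∧ ∀ x, fderiv ℝ (curl (v t)) x k = 0) :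
    ∀ t < 0, ∀ x, curl (v t) x = 0 := by
  have hsm' : IsSmoothSpaceTimeOn (Iio 0) v := hsm
  obtain ⟨t₀, ht₀, hfr⟩ := hflat
  have hneg0 : ∀ᶠ t in 𝓝 t₀, t < 0 := Iio_mem_nhds ht₀
  have hneg : ∀ᶠ t in 𝓝[≠] t₀, t < 0 := hneg0.filter_mono nhdsWithin_le_nhds
  refine curl_eq_zero_of_orthogonal_direction_frequently v x₀ hB hm hsm hun ⟨t₀, ht₀, ?_⟩
  refine (hfr.and_eventually hneg).mono fun t ⟨⟨k, hk, hD⟩, ht⟩ => ⟨k, hk, fun x => ?_⟩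
  have hv2 : ContDiff ℝ 2 (v t) := (hsm'.contDiff_slice ht).of_le (by norm_cast)
  exact inner_curl_eq_zero_of_fderiv_curl_apply_eq_zero hv2 x₀ k (hun t ht) hD x

/-- ★★ **TRANSLATION-INVARIANT SLICES AT ACCUMULATING TIMES ⇒ IRROTATIONAL** (2½-dimensional flows, flows periodic in one direction): if at times
accumulating at some `t₀ < 0` there is `k ≠ 0` with `v(t, x + k) = v(t, x)` for all `x`, then `curl v ≡ 0`. [Two centres: `x₀` and `x₀ − k`.]
[cite: KochNadirashviliSereginSverak2009, Thm 5.2 (arXiv:0709.3599 pp. 9–10)] -/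
theorem curl_eq_zero_of_translationInvariant_frequently
    (v : ℝ → EuclideanSpace ℝ (Fin 3) → EuclideanSpace ℝ (Fin 3)) (x₀ : EuclideanSpace ℝ (Fin 3))
    (hB : Literature.Analysis.FluidPDE.IsBoundedAncientMildSolution 1 v)
    (hm : ∀ t < 0, AEStronglyMeasurable (v t) volume)
    (hsm : ContDiffOn ℝ (⊤ : ℕ∞) (Function.uncurry v) (Set.Iio 0 ×ˢ Set.univ))
    (hun : ∀ t < 0, ∀ x, ⟪x - x₀, curl (v t) x⟫ = 0)
    (hinv : ∃ t₀ < 0, ∃ᶠ t in 𝓝[≠] t₀, ∃ k : EuclideanSpace ℝ (Fin 3), k ≠ 0 ∧ ∀ x, v t (x + k) = v t x) :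
    ∀ t < 0, ∀ x, curl (v t) x = 0 := by
  obtain ⟨t₀, ht₀, hfr⟩ := hinv
  have hneg0 : ∀ᶠ t in 𝓝 t₀, t < 0 := Iio_mem_nhds ht₀
  have hneg : ∀ᶠ t in 𝓝[≠] t₀, t < 0 := hneg0.filter_mono nhdsWithin_le_nhds
  refine curl_eq_zero_of_orthogonal_direction_frequently v x₀ hB hm hsm hun ⟨t₀, ht₀, ?_⟩
  refine (hfr.and_eventually hneg).mono fun t ⟨⟨k, hk, hinv⟩, ht⟩ => ⟨k, hk, fun x => ?_⟩
  -- the vorticity is `k`-periodic too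
  have hper : curl (v t) (x + k) = curl (v t) x := by
    have hfun : (fun y => v t (y + k)) = v t := funext hinv
    have h1 : curl (fun y => v t (y + k)) x = curl (v t) (x + k) := by
      rw [curl_eq_curlCLM, curl_eq_curlCLM, fderiv_comp_add_right]
    rw [← h1, hfun]
  have h0 := hun t ht x
  have h2 := hun t ht (x + k)
  rw [hper] at h2
  have e : k = (x + k - x₀) - (x - x₀) := by abel
  rw [e, inner_sub_left, h2, h0, sub_zero]

/-- ★★ **BELTRAMI FLOWS IN A GALILEAN FRAME ARE TRIVIAL**: if `(v(t, x) − b(t)) × curl v(t, x) = 0` for all `t < 0`, `x` (vorticity parallel to the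
velocity relative to a drift `b` smooth on `(−∞,0)`), then `curl v ≡ 0` (the Lamb vector vanishes identically; p816997).
[cite: KochNadirashviliSereginSverak2009, Thm 5.2 (arXiv:0709.3599 pp. 9–10)] -/
theorem curl_eq_zero_of_beltrami
    (v : ℝ → EuclideanSpace ℝ (Fin 3) → EuclideanSpace ℝ (Fin 3)) (x₀ : EuclideanSpace ℝ (Fin 3))
    (hB : Literature.Analysis.FluidPDE.IsBoundedAncientMildSolution 1 v)
    (hm : ∀ t < 0, AEStronglyMeasurable (v t) volume)
    (hsm : ContDiffOn ℝ (⊤ : ℕ∞) (Function.uncurry v) (Set.Iio 0 ×ˢ Set.univ))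
    (hun : ∀ t < 0, ∀ x, ⟪x - x₀, curl (v t) x⟫ = 0)
    (b : ℝ → EuclideanSpace ℝ (Fin 3)) (hb : ContDiffOn ℝ ∞ b (Iio 0))
    (hbel : ∀ t < 0, ∀ x, cross (v t x - b t) (curl (v t) x) = 0) :
    ∀ t < 0, ∀ x, curl (v t) x = 0 := by
  refine curl_eq_zero_of_lamb_curlFree v x₀ hB hm hsm hun b hb fun t ht x => ?_
  have hfun : (fun y => cross (v t y - b t) (curl (v t) y)) = fun _ => (0 : EuclideanSpace ℝ (Fin 3)) :=
    funext fun y => hbel t ht y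
  rw [hfun, curl_eq_curlCLM, fderiv_fun_const, Pi.zero_apply, map_zero]

/-- ★★ **… HENCE SLICE-WISE CONSTANT.** [cite: KochNadirashviliSereginSverak2009, Thm 5.2 (arXiv:0709.3599 pp. 9–10)] -/
theorem constant_of_beltrami
    (v : ℝ → EuclideanSpace ℝ (Fin 3) → EuclideanSpace ℝ (Fin 3)) (x₀ : EuclideanSpace ℝ (Fin 3))
    (hB : Literature.Analysis.FluidPDE.IsBoundedAncientMildSolution 1 v)
    (hm : ∀ t < 0, AEStronglyMeasurable (v t) volume)
    (hsm : ContDiffOn ℝ (⊤ : ℕ∞) (Function.uncurry v) (Set.Iio 0 ×ˢ Set.univ))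
    (hun : ∀ t < 0, ∀ x, ⟪x - x₀, curl (v t) x⟫ = 0)
    (b : ℝ → EuclideanSpace ℝ (Fin 3)) (hb : ContDiffOn ℝ ∞ b (Iio 0))
    (hbel : ∀ t < 0, ∀ x, cross (v t x - b t) (curl (v t) x) = 0) :
    ∀ t < 0, ∃ c : EuclideanSpace ℝ (Fin 3), ∀ x, v t x = c :=
  constantOfIrrotational v hB hsm (curl_eq_zero_of_beltrami v x₀ hB hm hsm hun b hb hbel)

end Summit.NavierStokesRegularity.NavierStokesRegularity.Theorems.PoloidalLiouville.Antidynamo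

end
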